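import Mathlib
import HarnessLib
import Summits.ValiantsHypothesis.ValiantsHypothesis.Theorems.KPlusLogSqLawWeakLiftingTowerGraftWronskianKFourOutside
import Summits.ValiantsHypothesis.ValiantsHypothesis.Theorems.KPlusLogSqLawWeakLiftingTowerGraftWronskianKFourLevelTables

/-!
# Tower graft line — CONJECTURE W AT `K = 4`: THE SHAPE OF A WOULD-BE COUNTEREXAMPLE (kernel summary)

Helper file for LINE (B) `Cruxes/WeakLifting/Lines/tower_graft.lean` (crux `WeakLifting` = stmt-ValiantsHypothesis-19561): a kernel
summary of what hands g10–g11 proved about a hypothetical fifth positive zero of `W(u,v)` for two real `4`-nomials on a common support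
(Conjecture W at `K = 4` ⟺ «Theorem A for lacunary arcs», [cite: SedykhShapiro2005]).  NO stub is claimed; the conjecture stays OPEN.

* ★ `turning_level_lt_thresholds` — on the fully alternating cell, at a positive zero `x` of `W(u,v)` with `U₁(x) ≠ 0` the level
  `c = U₂(x)/U₁(x)` lies STRICTLY BELOW one of the two thresholds: `p₁₂(p₀₂ − c p₀₁) < 0` or `p₁₂(−p₂₃ + c p₁₃) > 0`
  (i.e. `c < −min(|p₀₂|/p₀₁, |p₂₃|/p₁₃)`): the band where `U₂ − cU₁` has one sign change carries no turning level
  (`…KFourLevelTables.countP_posRoots_level12_le_one_of_band` against the double root `…KFourQuotients.level_double_root`);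
* ★★ `five_zeros_shape` — on the orientation `d₀ + d₃ < d₁ + d₂`, if `W(u,v)` has five positive zeros then the distinguished members
  `U₁, U₂, U₃` have positive roots `ρ₁, ρ₂, ρ₃` and EVERY positive zero of `W(u,v)` lies either below all three or above all three
  (`…KFourOutside.wronskian_root_outside_poles` + the strict sign conditions of `…KFourQuotients.special_products_of_five_le`).

Together with `special_products_of_five_le` (simple zeros, `U₁U₂ < 0`, `U₂U₃ < 0`, `U₁U₃ > 0`), `isLocalExtr_quotient_of_five_le`
(turning points) and the level tables, this is the kernel part of the memo `evidence-g11-conjectureW-K4-levels.md` (item evidence #41):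
the lap calculus there shows the zeros must split `4 + 1` around the poles with monotone pole order, and that single-quotient
Descartes information cannot exclude this.  HONEST FRAMING: nothing on S4/S4f/S5/S5ᴸ, TowerB, `WeakLifting`, Conjecture B,
`MatrixDescartes` (18050), `VP ≠ VNP`.  Def-free.  Seat: prover leafhand-val-kpluslogsqlaw-1 g11, `--supports stmt-ValiantsHypothesis-19561
--as helper`.  [this work]
-/

-- `Summit.ValiantsHypothesis.ValiantsHypothesis.…` repeats a component by the D-0017 layout
-- (single-conjunct summit), which the `dupNamespace` linter flags; the name is mandated.
set_option linter.dupNamespace false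
set_option autoImplicit false

namespace Summit.ValiantsHypothesis.ValiantsHypothesis.Theorems.KPlusLogSqLaw.TowerGraft

open Polynomial Finset
open scoped BigOperators Polynomial

namespace WronskianDevelopable

/-- ★ **turning levels lie strictly below the one-change band.** [this work] -/
theorem turning_level_lt_thresholds (u v : Fin 4 → ℝ) (d : Fin 4 → ℕ) (hd : StrictMono d)
    (h1 : (u 0 * v 1 - u 1 * v 0) * (u 0 * v 2 - u 2 * v 0) < 0) (h2 : (u 0 * v 2 - u 2 * v 0) * (u 0 * v 3 - u 3 * v 0) < 0)
    (h3 : (u 0 * v 3 - u 3 * v 0) * (u 1 * v 2 - u 2 * v 1) < 0) (h4 : (u 1 * v 2 - u 2 * v 1) * (u 1 * v 3 - u 3 * v 1) < 0)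
    (h5 : (u 1 * v 3 - u 3 * v 1) * (u 2 * v 3 - u 3 * v 2) < 0) {x : ℝ} (hx : 0 < x)
    (hW : (wronskian (∑ l, C (u l) * (X : ℝ[X]) ^ d l) (∑ l, C (v l) * (X : ℝ[X]) ^ d l)).eval x = 0)
    (hU₁ : (∑ l, C (u l * v 1 - u 1 * v l) * (X : ℝ[X]) ^ d l).eval x ≠ 0) :
    (u 1 * v 2 - u 2 * v 1) * ((u 0 * v 2 - u 2 * v 0) -
        ((∑ l, C (u l * v 2 - u 2 * v l) * (X : ℝ[X]) ^ d l).eval x /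
          (∑ l, C (u l * v 1 - u 1 * v l) * (X : ℝ[X]) ^ d l).eval x) * (u 0 * v 1 - u 1 * v 0)) < 0 ∨
      0 < (u 1 * v 2 - u 2 * v 1) * ((u 3 * v 2 - u 2 * v 3) -
        ((∑ l, C (u l * v 2 - u 2 * v l) * (X : ℝ[X]) ^ d l).eval x /
          (∑ l, C (u l * v 1 - u 1 * v l) * (X : ℝ[X]) ^ d l).eval x) * (u 3 * v 1 - u 1 * v 3)) := by
  obtain ⟨hA, hB, hC, hne12⟩ := cell_signs u v h1 h2 h3 h4 h5
  set U₁ : ℝ[X] := ∑ l, C (u l * v 1 - u 1 * v l) * (X : ℝ[X]) ^ d l with hU₁def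
  set U₂ : ℝ[X] := ∑ l, C (u l * v 2 - u 2 * v l) * (X : ℝ[X]) ^ d l with hU₂def
  set c : ℝ := U₂.eval x / U₁.eval x with hc
  -- the level `c` is negative (localization) and has a double root at `x`
  have hcneg : c < 0 := by
    rcases wronskian_root_special_product_neg u v d hd h1 h2 h3 h4 h5 hx hW with hneg | ⟨hz, -⟩
    · have hsq : 0 < U₁.eval x * U₁.eval x := mul_self_pos.mpr hU₁
      have e : c = (U₁.eval x * U₂.eval x) / (U₁.eval x * U₁.eval x) := by
        rw [hc]; field_simp
      rw [e]; exact div_neg_of_neg_of_pos hneg hsq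
    · exact absurd hz hU₁
  have hW12 : (wronskian U₁ U₂).eval x = 0 := by
    rw [hU₁def, hU₂def, wronskian_special_members, eval_mul, eval_C, hW, mul_zero]
  obtain ⟨hf0, hf1⟩ := level_double_root U₁ U₂ hU₁ hW12
  have hlevel : U₂ - C c * U₁ = ∑ l, C ((u l * v 2 - u 2 * v l) - c * (u l * v 1 - u 1 * v l)) * (X : ℝ[X]) ^ d l := by
    rw [hU₁def, hU₂def]; exact level_member_eq u v d c
  have hfne : U₂ - C c * U₁ ≠ 0 := by
    intro h0
    have hcoeff := coeff_fewnomial_four (fun l => (u l * v 2 - u 2 * v l) - c * (u l * v 1 - u 1 * v l)) d hd 1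
    rw [← hlevel, h0, coeff_zero] at hcoeff
    apply hne12
    have : (u 1 * v 2 - u 2 * v 1) - c * (u 1 * v 1 - u 1 * v 1) = u 1 * v 2 - u 2 * v 1 := by ring
    linarith [this]
  have h2le := two_le_countP_posRoots_of_double_root _ hfne hx hf0 hf1
  by_contra hboth
  push Not at hboth
  obtain ⟨hlow, htop⟩ := hboth
  have h1le := countP_posRoots_level12_le_one_of_band u v d hd h4 hcneg.le hlow htop
  rw [← hlevel] at h1le
  omega

/-- ★★ **THE SHAPE OF A COUNTEREXAMPLE**: five positive zeros (orientation `d₀ + d₃ < d₁ + d₂`) force positive roots `ρ₁, ρ₂, ρ₃` of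
`U₁, U₂, U₃` such that every positive zero of `W(u,v)` lies below all three or above all three. [this work] -/
theorem five_zeros_shape (u v : Fin 4 → ℝ) (d : Fin 4 → ℕ) (hd : StrictMono d) (hA : d 0 + d 3 < d 1 + d 2)
    (h5 : 5 ≤ ((wronskian (∑ l, C (u l) * (X : ℝ[X]) ^ d l) (∑ l, C (v l) * (X : ℝ[X]) ^ d l)).roots.toFinset.filter
      (fun x => 0 < x)).card) :
    ∃ ρ₁ ρ₂ ρ₃ : ℝ, 0 < ρ₁ ∧ 0 < ρ₂ ∧ 0 < ρ₃ ∧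
      (∑ l, C (u l * v 1 - u 1 * v l) * (X : ℝ[X]) ^ d l).eval ρ₁ = 0 ∧
      (∑ l, C (u l * v 2 - u 2 * v l) * (X : ℝ[X]) ^ d l).eval ρ₂ = 0 ∧
      (∑ l, C (u l * v 3 - u 3 * v l) * (X : ℝ[X]) ^ d l).eval ρ₃ = 0 ∧
      ∀ x ∈ (wronskian (∑ l, C (u l) * (X : ℝ[X]) ^ d l) (∑ l, C (v l) * (X : ℝ[X]) ^ d l)).roots.toFinset.filter
          (fun x => 0 < x),
        (x < ρ₁ ∧ x < ρ₂ ∧ x < ρ₃) ∨ (ρ₁ < x ∧ ρ₂ < x ∧ ρ₃ < x) := by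
  classical
  set W : ℝ[X] := wronskian (∑ l, C (u l) * (X : ℝ[X]) ^ d l) (∑ l, C (v l) * (X : ℝ[X]) ^ d l) with hWdef
  obtain ⟨c1, c2, c3, c4, c5⟩ := plucker_alternating_of_five_le u v d hd hA h5
  obtain ⟨ρ₁, hρ₁, hr1, -, -⟩ := special_one_root_structure u v d hd c1 c2 c3 c4 c5
  obtain ⟨ρ₂, hρ₂, hr2, -, -⟩ := special_two_root_structure u v d hd c1 c2 c3 c4 c5
  obtain ⟨ρ₃, hρ₃, hr3, -, -⟩ := special_three_root_structure u v d hd c1 c2 c3 c4 c5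
  refine ⟨ρ₁, ρ₂, ρ₃, hρ₁, hρ₂, hρ₃, hr1, hr2, hr3, fun x hx => ?_⟩
  have hW : W ≠ 0 := by
    intro h0
    have : (W.roots.toFinset.filter (fun x => 0 < x)).card = 0 := by simp [h0]
    omega
  have hx' := hx
  rw [Finset.mem_filter, Multiset.mem_toFinset] at hx'
  have hxpos : 0 < x := hx'.2
  have hWx : W.eval x = 0 := (mem_roots hW).mp hx'.1
  obtain ⟨h12, h23, h13, -⟩ := special_products_of_five_le u v d hd hA h5 hx
  -- `x` is not a root of any `U_k`
  have hn1 : (∑ l, C (u l * v 1 - u 1 * v l) * (X : ℝ[X]) ^ d l).eval x ≠ 0 := by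
    intro h0; rw [h0, zero_mul] at h12; exact lt_irrefl 0 h12
  have hn2 : (∑ l, C (u l * v 2 - u 2 * v l) * (X : ℝ[X]) ^ d l).eval x ≠ 0 := by
    intro h0; rw [h0, mul_zero] at h12; exact lt_irrefl 0 h12
  by_contra hnot
  push Not at hnot
  obtain ⟨hlo', hhi'⟩ := hnot
  -- some pole is `≤ x` and some pole is `≥ x`
  have hlo : ρ₁ ≤ x ∨ ρ₂ ≤ x ∨ ρ₃ ≤ x := by
    by_contra h
    push Not at h
    exact absurd (hlo' h.1 h.2.1) (not_le.mpr h.2.2)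
  have hhi : x ≤ ρ₁ ∨ x ≤ ρ₂ ∨ x ≤ ρ₃ := by
    by_contra h
    push Not at h
    exact absurd (hhi' h.1 h.2.1) (not_le.mpr h.2.2)
  rcases wronskian_root_outside_poles u v d hd c1 c2 c3 c4 c5 hxpos hWx hρ₁ hr1 hρ₂ hr2 hρ₃ hr3 hlo hhi with
    ⟨e1, -⟩ | ⟨e2, -⟩ | ⟨e1, -⟩
  · exact hn1 (by rw [e1]; exact hr1)
  · exact hn2 (by rw [e2]; exact hr2)
  · exact hn1 (by rw [e1]; exact hr1)

end WronskianDevelopable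

end Summit.ValiantsHypothesis.ValiantsHypothesis.Theorems.KPlusLogSqLaw.TowerGraft
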